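import Literature.Geometry.Lorentzian.KerrRicciFlat
import Literature.Geometry.Lorentzian.KerrSchildChartCovariance
import Literature.Geometry.Lorentzian.KerrIngoingCoordConnection
import Literature.Geometry.Lorentzian.CoordCurvatureCubicTrace
import HarnessLib

/-!
# Kerr curvature invariants: transport from ingoing Kerr coordinates to the Kerr–Schild chart

Glue (everything proved; no definition, no named fact) for the closed forms of the quadratic and
cubic curvature invariants of the Kerr metric in the tree's INGOING KERR–SCHILD CARTESIAN chart
(`Kerr.bilin M a`, `KerrSchild.lean`) — the Kretschmann scalar
`|Rm|² = 48 M² Re (r + i a cos θ)⁶ / Σ⁶` (`Kerr.kretschmannScalar_closedForm`,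
`KerrKretschmannScalar.lean`; Visser arXiv:0706.0622, §3; Henry, ApJ 535 (2000) 350) and the cubic
trace invariant `Σ g g g tr(R R R) = 48 M³ Re (r + i a cos θ)⁹ / Σ⁹` (type D,
`Ψ₂ = −M/(r − i a cos θ)³`; the hypotheses `hQ`, `hT` of
`…Theorems.PhotonSphereChannels.TameCensorshipCrush.stub_phaseRigidity_main`).

The heavy computation is done in Kerr's ingoing coordinates `u = (t*, r, μ, φ)` on the rational
component field `Kerr.Ingoing.bilin M a` (`KerrIngoingCoordMetric.lean` … `KerrIngoingCoordConnectionII.lean`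
and sequels). This file proves, once and for all, that such a coordinate-basis closed form on the
coordinate domain `{r > 0, −1 < μ < 1}` IMPLIES the statement in the Cartesian chart at every point
with `r > 0`, in the verbatim form of the registered stubs:

* `Kerr.Ingoing.isCoordChangeOn_chartFun` — the chart map `Ψ` (`KerrIngoingCoordChart.lean`) is a
  change of coordinates `coordDomain r₀ → region a r₀` (`MetricCoord.IsCoordChangeOn`), and
  `Kerr.Ingoing.pullMetric_chartFun` — `Ψ^*(Kerr.bilin) = Kerr.Ingoing.bilin` there
  (`Kerr.Ingoing.kerrBilin_jac`);
* `Kerr.Ingoing.rmNormSqAt_kerrBilin_chartFun` — `|Rm|²` of the Cartesian components at `Ψ u` is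
  `|Rm|²` of the ingoing components at `u` (naturality `MetricCoord.rmNormSqAt_pullMetric` and
  locality);
* `Kerr.rmNormSqAt_kerrBilin_of_ingoing` — **transport of the Kretschmann closed form**: from
  `|Rm|²(Kerr.Ingoing.bilin)(u) = 48M²(r⁶ − 15r⁴s² + 15r²s⁴ − s⁶)/(r² + s²)⁶`, `s = aμ`, on the
  coordinate domain, to `MetricCoord.rmNormSqAt (Kerr.bilin M a) x = 48 M² Re(r + i a x₃/r)⁶/Σ⁶`
  for ALL `x` with `r > 0` — off the rotation axis by the chart (`Kerr.Ingoing.exists_chartFun_eq`),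
  on the axis `{x₁ = x₂ = 0}` (outside every such chart) by continuity and density
  (`Kerr.eqOn_region_of_offAxis`, `MetricCoord.IsMetricOn.contDiffOn_rmNormSqAt`);
* `Kerr.Ingoing.cubicTrace_kerrBilin_chartFun`, `Kerr.cubicTrace_kerrBilin_of_ingoing` — the same
  two steps for the **cubic trace invariant** `Σ g^{ii'}g^{jj'}g^{kk'} tr(R(b_i,b_j)(R(b_{j'},b_k)R(b_{k'},b_{i'})))`
  in an ARBITRARY basis `b` of `E4` (naturality `MetricCoord.cubicTrace_pullMetric`, basis
  independence `MetricCoord.cubicTrace_eq_of_basis`, locality, continuity): from the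
  coordinate-basis closed form `48M³(r⁹ − 36r⁷s² + 126r⁵s⁴ − 84r³s⁶ + 9rs⁸)/(r² + s²)⁹` of the
  ingoing components to `48 M³ Re(r + i a x₃/r)⁹/Σ⁹` for `Kerr.bilin M a`, all `x` with `r > 0`, all
  bases — verbatim `stub_factKerrCubicWeyl`;
* `Complex.re_add_mul_I_pow_six`, `Complex.re_add_mul_I_pow_nine` — `Re (r + i s)⁶`,
  `Re (r + i s)⁹` as real polynomials.

O'Neill 1983, Ch. 3, Prop. 3.59 (curvature is natural under isometries); Visser arXiv:0706.0622,
§§3–5 ("the invariant … looks identical … because the `r` and `θ` coordinates have not been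
modified").

## References

* B. O'Neill, *Semi-Riemannian geometry with applications to relativity* (1983), Ch. 3,
  Prop. 3.59. [ONeill1983]
* M. Visser, *The Kerr spacetime: a brief introduction*, arXiv:0706.0622, §3, §4, §5. [arXiv07060622]
* R. C. Henry, *Kretschmann scalar for a Kerr–Newman black hole*, Astrophys. J. 535 (2000) 350.
-/

noncomputable section

set_option maxSynthPendingDepth 3

open Set Function Module Filter Real
open scoped ContDiff Topology
open Literature.Geometry.Lorentzian.MetricCoord

/-! ### Real parts of `(r + i s)⁶` and `(r + i s)⁹` -/

namespace Complex

/-- `Re (r + i s)⁶ = r⁶ − 15 r⁴ s² + 15 r² s⁴ − s⁶` (binomial theorem). [folklore] -/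
theorem re_add_mul_I_pow_six (r s : ℝ) :
    (((r : ℂ) + (s : ℂ) * I) ^ 6).re = r ^ 6 - 15 * r ^ 4 * s ^ 2 + 15 * r ^ 2 * s ^ 4 - s ^ 6 := by
  have h2 : ((r : ℂ) + (s : ℂ) * I) ^ 2 = ((r ^ 2 - s ^ 2 : ℝ) : ℂ) + ((2 * r * s : ℝ) : ℂ) * I := by
    push_cast
    ring_nf
    rw [I_sq]
    ring
  have h6 : ((r : ℂ) + (s : ℂ) * I) ^ 6 = (((r : ℂ) + (s : ℂ) * I) ^ 2) ^ 3 := by ring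
  rw [h6, h2]
  set p : ℝ := r ^ 2 - s ^ 2
  set q : ℝ := 2 * r * s
  have h3 : (((p : ℂ) + (q : ℂ) * I)) ^ 3 =
      ((p ^ 3 - 3 * p * q ^ 2 : ℝ) : ℂ) + ((3 * p ^ 2 * q - q ^ 3 : ℝ) : ℂ) * I := by
    push_cast
    ring_nf
    rw [I_sq, show I ^ 3 = I ^ 2 * I by ring, I_sq]
    ring
  rw [h3, add_re, ofReal_re, re_ofReal_mul, I_re, mul_zero, add_zero]
  simp only [p, q]
  ring

/-- `Re (r + i s)⁹ = r⁹ − 36 r⁷ s² + 126 r⁵ s⁴ − 84 r³ s⁶ + 9 r s⁸` (binomial theorem). [folklore] -/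
theorem re_add_mul_I_pow_nine (r s : ℝ) :
    (((r : ℂ) + (s : ℂ) * I) ^ 9).re =
      r ^ 9 - 36 * r ^ 7 * s ^ 2 + 126 * r ^ 5 * s ^ 4 - 84 * r ^ 3 * s ^ 6 + 9 * r * s ^ 8 := by
  have h3 : ∀ p q : ℝ, (((p : ℂ) + (q : ℂ) * I)) ^ 3 =
      ((p ^ 3 - 3 * p * q ^ 2 : ℝ) : ℂ) + ((3 * p ^ 2 * q - q ^ 3 : ℝ) : ℂ) * I := by
    intro p q
    push_cast
    ring_nf
    rw [I_sq, show I ^ 3 = I ^ 2 * I by ring, I_sq]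
    ring
  have h9 : ((r : ℂ) + (s : ℂ) * I) ^ 9 = (((r : ℂ) + (s : ℂ) * I) ^ 3) ^ 3 := by ring
  rw [h9, h3 r s, h3, add_re, ofReal_re, re_ofReal_mul, I_re, mul_zero, add_zero]
  ring

end Complex

namespace Literature.Geometry.Lorentzian

/-! ### Locality of `g⁻¹` and `|Rm|²` in the components -/

namespace MetricCoord

variable {E : Type*} [NormedAddCommGroup E] [NormedSpace ℝ E] [FiniteDimensional ℝ E]
  {ι : Type*} (b : Basis ι ℝ E) {G G' : E → E →L[ℝ] E →L[ℝ] ℝ} {U : Set E} {x : E}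

/-- The inverse metric coefficients at `x` only depend on `G x`. [folklore] -/
theorem ginv_congr_pt (h : G x = G' x) (i j : ι) : ginv G b x i j = ginv G' b x i j := by
  simp only [ginv, sharpAt, h]

/-- `|Rm|²_G (x)` only depends on the components on an open set around `x`. [folklore] -/
theorem rmNormSqAt_congr_of_eqOn (hU : IsOpen U) (h : ∀ y ∈ U, G y = G' y) (hx : x ∈ U) :
    rmNormSqAt G x = rmNormSqAt G' x := by
  set b₀ := Module.finBasis ℝ E
  rw [rmNormSqAt_eq_sum b₀, rmNormSqAt_eq_sum b₀]
  simp only [riemAt_congr_of_eqOn hU h hx, ginv_congr_pt b₀ (h x hx)]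

/-- The cubic trace sum at `x` (in a fixed basis) only depends on the components on an open set
around `x`. [folklore] -/
theorem cubicTrace_congr_of_eqOn {κ : Type*} [Fintype κ] (e : Basis κ ℝ E) (hU : IsOpen U)
    (h : ∀ y ∈ U, G y = G' y) (hx : x ∈ U) :
    ∑ i, ∑ i', ∑ j, ∑ j', ∑ k, ∑ k', ginv G e x i i' * ginv G e x j j' * ginv G e x k k' *
        traceCLM E ((riemAt G x (e i) (e j)).comp
          ((riemAt G x (e j') (e k)).comp (riemAt G x (e k') (e i')))) =
      ∑ i, ∑ i', ∑ j, ∑ j', ∑ k, ∑ k', ginv G' e x i i' * ginv G' e x j j' * ginv G' e x k k' *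
        traceCLM E ((riemAt G' x (e i) (e j)).comp
          ((riemAt G' x (e j') (e k)).comp (riemAt G' x (e k') (e i')))) := by
  simp only [riemAt_congr_of_eqOn hU h hx, ginv_congr_pt e (h x hx)]

/-- The cubic trace sum (fixed basis) is `C^∞` on `V` for metric components on `V` (a polynomial in
`g⁻¹` and the components of `R`). [folklore] -/
theorem IsMetricOn.contDiffOn_cubicTrace [CompleteSpace E] {κ : Type*} [Fintype κ] (e : Basis κ ℝ E)
    {V : Set E} (hG : IsMetricOn G V) :
    ContDiffOn ℝ ∞ (fun y ↦ ∑ i, ∑ i', ∑ j, ∑ j', ∑ k, ∑ k',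
      ginv G e y i i' * ginv G e y j j' * ginv G e y k k' *
        traceCLM E ((riemAt G y (e i) (e j)).comp
          ((riemAt G y (e j') (e k)).comp (riemAt G y (e k') (e i'))))) V := by
  refine ContDiffOn.sum fun i _ ↦ ContDiffOn.sum fun i' _ ↦ ContDiffOn.sum fun j _ ↦
    ContDiffOn.sum fun j' _ ↦ ContDiffOn.sum fun k _ ↦ ContDiffOn.sum fun k' _ ↦ ?_
  exact (((hG.contDiffOn_ginv e i i').mul (hG.contDiffOn_ginv e j j')).mul
    (hG.contDiffOn_ginv e k k')).mul ((traceCLM E).contDiff.comp_contDiffOn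
      ((hG.contDiffOn_riemAt (e i) (e j)).clm_comp
        ((hG.contDiffOn_riemAt (e j') (e k)).clm_comp (hG.contDiffOn_riemAt (e k') (e i')))))

end MetricCoord

namespace Kerr

namespace Ingoing

variable (M a : ℝ) {r₀ : ℝ} {u : E4}

/-! ### The ingoing chart as a change of coordinates for the component calculus -/

/-- **The ingoing Kerr chart is a change of coordinates** `coordDomain r₀ → region a r₀` in the
sense of `MetricCoord.IsCoordChangeOn`: `C^∞` on the open coordinate domain, into the chart domain,
with invertible Jacobian (`Kerr.Ingoing.jac_injective`). [cite: arXiv07060622, §4] -/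
theorem isCoordChangeOn_chartFun (a r₀ : ℝ) :
    IsCoordChangeOn (chartFun a r₀) (coordDomain r₀ : Set E4) (region a r₀ : Set E4) where
  isOpen := (coordDomain r₀).isOpen
  contDiffOn := fun _ hu ↦ (contDiffAt_chartFun hu).contDiffWithinAt
  mapsTo := fun u _ ↦ chartFun_mem_region a r₀ u
  isInvertible := fun _ hu ↦ by
    rw [fderiv_chartFun hu]
    exact KerrSchildChart.isInvertible_of_injective (jac_injective hu)

/-- **The pulled-back Kerr–Schild components are the ingoing components** on the coordinate
domain: `Ψ^*(Kerr.bilin M a) = Kerr.Ingoing.bilin M a` (`kerrBilin_jac`, `fderiv_chartFun`).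
[cite: arXiv07060622, (E:K1)–(E:K2)] -/
theorem pullMetric_chartFun (hu : u ∈ coordDomain r₀) :
    pullMetric (Kerr.bilin M a) (chartFun a r₀) u = bilin M a u := by
  ext v w
  rw [pullMetric_apply, fderiv_chartFun hu, kerrBilin_jac hu]

/-- **`|Rm|²` is a scalar**: the square norm of the curvature of the Kerr–Schild Cartesian
components at `Ψ u` equals that of the ingoing components at `u` (naturality
`rmNormSqAt_pullMetric` + locality). [cite: ONeill1983, Ch. 3, Prop. 3.59] -/
theorem rmNormSqAt_kerrBilin_chartFun (hu : u ∈ coordDomain r₀) :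
    rmNormSqAt (Kerr.bilin M a) (chartFun a r₀ u) = rmNormSqAt (bilin M a) u := by
  rw [← rmNormSqAt_pullMetric (KerrSchildChart.isMetricOn_kerrBilin M a r₀) (isCoordChangeOn_chartFun a r₀) hu]
  exact rmNormSqAt_congr_of_eqOn (coordDomain r₀).isOpen (fun y hy ↦ pullMetric_chartFun M a hy) hu

/-- Along the chart, `r(Ψ u) = u¹` on the coordinate domain. [cite: arXiv07060622, §4] -/
theorem radius_chartFun_of_mem (hu : u ∈ coordDomain r₀) : radius a (chartFun a r₀ u) = u 1 := by
  rw [radius_chartFun, radialParam_of_lt hu.1]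

/-- Along the chart, `x₃(Ψ u) = u¹ u²` (`z = r cos θ`, `μ = cos θ`). [cite: arXiv07060622, §4] -/
theorem chartFun_apply_three (hu : u ∈ coordDomain r₀) : chartFun a r₀ u 3 = u 1 * u 2 := by
  rw [chartFun_eq hu, show (3 : Fin 4) = (2 : Fin 3).succ from rfl, E4.ofTimeSpace_apply_succ,
    kerrStar_apply_two, cos_arccos_eq hu]

/-- Along the chart, `a x₃ / r = a μ`. [cite: arXiv07060622, §4] -/
theorem mul_apply_three_div_radius (hu : u ∈ coordDomain r₀) :
    a * (chartFun a r₀ u 3 / radius a (chartFun a r₀ u)) = a * u 2 := by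
  rw [chartFun_apply_three a hu, radius_chartFun_of_mem a hu,
    mul_div_cancel_left₀ _ (radial_pos hu).ne']

/-- **The cubic trace invariant is a scalar**: in ANY basis `b` of `E4`, the cubic trace sum of the
Kerr–Schild Cartesian components at `Ψ u` equals the coordinate-basis cubic trace sum of the
ingoing components at `u` (basis independence `cubicTrace_eq_of_basis`, naturality
`cubicTrace_pullMetric`, locality). [cite: ONeill1983, Ch. 3, Prop. 3.59] -/
theorem cubicTrace_kerrBilin_chartFun (hu : u ∈ coordDomain r₀) {κ : Type*} [Fintype κ]
    (b : Basis κ ℝ E4) :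
    ∑ i, ∑ i', ∑ j, ∑ j', ∑ k, ∑ k',
        ginv (Kerr.bilin M a) b (chartFun a r₀ u) i i' * ginv (Kerr.bilin M a) b (chartFun a r₀ u) j j' *
        ginv (Kerr.bilin M a) b (chartFun a r₀ u) k k' *
        traceCLM E4 ((riemAt (Kerr.bilin M a) (chartFun a r₀ u) (b i) (b j)).comp
          ((riemAt (Kerr.bilin M a) (chartFun a r₀ u) (b j') (b k)).comp
            (riemAt (Kerr.bilin M a) (chartFun a r₀ u) (b k') (b i')))) =
      ∑ i, ∑ i', ∑ j, ∑ j', ∑ k, ∑ k',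
        ginv (bilin M a) (EuclideanSpace.basisFun (Fin 4) ℝ).toBasis u i i' *
        ginv (bilin M a) (EuclideanSpace.basisFun (Fin 4) ℝ).toBasis u j j' *
        ginv (bilin M a) (EuclideanSpace.basisFun (Fin 4) ℝ).toBasis u k k' *
        traceCLM E4 ((riemAt (bilin M a) u (E4.basisVector i) (E4.basisVector j)).comp
          ((riemAt (bilin M a) u (E4.basisVector j') (E4.basisVector k)).comp
            (riemAt (bilin M a) u (E4.basisVector k') (E4.basisVector i')))) := by
  set e := (EuclideanSpace.basisFun (Fin 4) ℝ).toBasis with he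
  obtain ⟨D, hD⟩ := (isCoordChangeOn_chartFun a r₀).isInvertible u hu
  rw [cubicTrace_eq_of_basis (Kerr.bilin M a) b (e.map D.toLinearEquiv) (chartFun a r₀ u),
    ← cubicTrace_pullMetric e (KerrSchildChart.isMetricOn_kerrBilin M a r₀)
      (isCoordChangeOn_chartFun a r₀) hu hD,
    cubicTrace_congr_of_eqOn e (coordDomain r₀).isOpen (fun y hy ↦ pullMetric_chartFun M a hy) hu]
  simp only [he, basisFun_toBasis_apply]

end Ingoing

/-! ### Transport of the Kretschmann closed form -/

/-- The real closed form `48 M² (r⁶ − 15 r⁴ s² + 15 r² s⁴ − s⁶)/(r² + s²)⁶`, `s = a x₃ / r`, is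
continuous on `{r > 0}`. [folklore] -/
theorem continuousOn_kretschmannRHS (M a : ℝ) :
    ContinuousOn (fun x : E4 ↦ 48 * M ^ 2 *
      (radius a x ^ 6 - 15 * radius a x ^ 4 * (a * (x 3 / radius a x)) ^ 2 +
        15 * radius a x ^ 2 * (a * (x 3 / radius a x)) ^ 4 - (a * (x 3 / radius a x)) ^ 6) /
      (radius a x ^ 2 + (a * (x 3 / radius a x)) ^ 2) ^ 6) (region a 0 : Set E4) := by
  have hr : ContinuousOn (radius a) (region a 0 : Set E4) := (continuous_radius a).continuousOn
  have h3 : ContinuousOn (fun x : E4 ↦ x 3) (region a 0 : Set E4) :=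
    (EuclideanSpace.proj (3 : Fin 4)).continuous.continuousOn
  have hs : ContinuousOn (fun x : E4 ↦ a * (x 3 / radius a x)) (region a 0 : Set E4) :=
    continuousOn_const.mul (h3.div hr fun x hx ↦ (radius_pos_of_mem_region hx).ne')
  refine ContinuousOn.div (continuousOn_const.mul ?_) ((hr.pow 2).add (hs.pow 2) |>.pow 6) ?_
  · exact (((hr.pow 6).sub ((continuousOn_const.mul (hr.pow 4)).mul (hs.pow 2))).add
      ((continuousOn_const.mul (hr.pow 2)).mul (hs.pow 4))).sub (hs.pow 6)
  · intro x hx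
    have := radius_pos_of_mem_region hx
    positivity

/-- **Transport of the Kretschmann closed form from ingoing Kerr coordinates to the Kerr–Schild
chart.** If the square norm of the curvature of the ingoing components `Kerr.Ingoing.bilin M a`
has the closed form `48 M² (r⁶ − 15 r⁴ s² + 15 r² s⁴ − s⁶)/(r² + s²)⁶`, `r = u¹`, `s = a u²`, at
every point of the coordinate domain `{r > 0, −1 < μ < 1}`, then the Kretschmann scalar of the
Kerr–Schild Cartesian components is `48 M² Re (r + i a cos θ)⁶ / Σ⁶`, `cos θ = x₃/r`, at EVERY
point with `r > 0` (axis included, by continuity) — verbatim `Kerr.kretschmannScalar_closedForm`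
/ `stub_factKerrKretschmann`. [cite: arXiv07060622, §3 and §5] -/
theorem rmNormSqAt_kerrBilin_of_ingoing (M a : ℝ)
    (H : ∀ u ∈ (Ingoing.coordDomain 0 : Set E4), rmNormSqAt (Ingoing.bilin M a) u =
      48 * M ^ 2 * (u 1 ^ 6 - 15 * u 1 ^ 4 * (a * u 2) ^ 2 + 15 * u 1 ^ 2 * (a * u 2) ^ 4 -
        (a * u 2) ^ 6) / (u 1 ^ 2 + (a * u 2) ^ 2) ^ 6)
    (x : E4) (hx : 0 < radius a x) :
    rmNormSqAt (Kerr.bilin M a) x = 48 * M ^ 2 *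
      (((radius a x : ℂ) + ((a * (x 3 / radius a x) : ℝ) : ℂ) * Complex.I) ^ 6).re /
        (radius a x ^ 2 + (a * (x 3 / radius a x)) ^ 2) ^ 6 := by
  rw [Complex.re_add_mul_I_pow_six]
  have hxr : x ∈ (region a 0 : Set E4) := by
    rw [SetLike.mem_coe, mem_region, max_self]; exact hx
  -- the difference `|Rm|² − closed form` is continuous on `{r > 0}` and vanishes off the axis
  set F : E4 → ℝ := fun x ↦ rmNormSqAt (Kerr.bilin M a) x - 48 * M ^ 2 *
      (radius a x ^ 6 - 15 * radius a x ^ 4 * (a * (x 3 / radius a x)) ^ 2 +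
        15 * radius a x ^ 2 * (a * (x 3 / radius a x)) ^ 4 - (a * (x 3 / radius a x)) ^ 6) /
      (radius a x ^ 2 + (a * (x 3 / radius a x)) ^ 2) ^ 6 with hF
  have hcont : ContinuousOn F (region a 0 : Set E4) :=
    ((KerrSchildChart.isMetricOn_kerrBilin M a 0).contDiffOn_rmNormSqAt.continuousOn).sub
      (continuousOn_kretschmannRHS M a)
  have hoff : ∀ y ∈ region a 0, (y 1 ≠ 0 ∨ y 2 ≠ 0) → F y = 0 := by
    intro y hy hax
    obtain ⟨u, hu, rfl⟩ := Ingoing.exists_chartFun_eq hy hax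
    simp only [hF]
    rw [Ingoing.rmNormSqAt_kerrBilin_chartFun M a hu, H u hu, Ingoing.mul_apply_three_div_radius a hu,
      Ingoing.radius_chartFun_of_mem a hu, sub_self]
  have := eqOn_region_of_offAxis hcont hoff x hxr
  simp only [hF] at this
  linarith

/-! ### Transport of the cubic closed form -/

/-- The real closed form `48 M³ (r⁹ − 36 r⁷ s² + 126 r⁵ s⁴ − 84 r³ s⁶ + 9 r s⁸)/(r² + s²)⁹`,
`s = a x₃ / r`, is continuous on `{r > 0}`. [folklore] -/
theorem continuousOn_cubicRHS (M a : ℝ) :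
    ContinuousOn (fun x : E4 ↦ 48 * M ^ 3 *
      (radius a x ^ 9 - 36 * radius a x ^ 7 * (a * (x 3 / radius a x)) ^ 2 +
        126 * radius a x ^ 5 * (a * (x 3 / radius a x)) ^ 4 -
        84 * radius a x ^ 3 * (a * (x 3 / radius a x)) ^ 6 +
        9 * radius a x * (a * (x 3 / radius a x)) ^ 8) /
      (radius a x ^ 2 + (a * (x 3 / radius a x)) ^ 2) ^ 9) (region a 0 : Set E4) := by
  have hr : ContinuousOn (radius a) (region a 0 : Set E4) := (continuous_radius a).continuousOn
  have h3 : ContinuousOn (fun x : E4 ↦ x 3) (region a 0 : Set E4) :=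
    (EuclideanSpace.proj (3 : Fin 4)).continuous.continuousOn
  have hs : ContinuousOn (fun x : E4 ↦ a * (x 3 / radius a x)) (region a 0 : Set E4) :=
    continuousOn_const.mul (h3.div hr fun x hx ↦ (radius_pos_of_mem_region hx).ne')
  refine ContinuousOn.div (continuousOn_const.mul ?_) ((hr.pow 2).add (hs.pow 2) |>.pow 9) ?_
  · exact ((((hr.pow 9).sub ((continuousOn_const.mul (hr.pow 7)).mul (hs.pow 2))).add
      ((continuousOn_const.mul (hr.pow 5)).mul (hs.pow 4))).sub
      ((continuousOn_const.mul (hr.pow 3)).mul (hs.pow 6))).add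
      ((continuousOn_const.mul hr).mul (hs.pow 8))
  · intro x hx
    have := radius_pos_of_mem_region hx
    positivity

/-- **Transport of the cubic closed form from ingoing Kerr coordinates to the Kerr–Schild chart.**
If the coordinate-basis cubic trace sum of the ingoing components `Kerr.Ingoing.bilin M a` has the
closed form `48 M³ (r⁹ − 36 r⁷ s² + 126 r⁵ s⁴ − 84 r³ s⁶ + 9 r s⁸)/(r² + s²)⁹`, `r = u¹`, `s = a u²`,
on the coordinate domain `{r > 0, −1 < μ < 1}`, then in EVERY basis `b` of `E4` the cubic trace sum
of the Kerr–Schild Cartesian components is `48 M³ Re (r + i a cos θ)⁹ / Σ⁹`, `cos θ = x₃/r`, at EVERY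
point with `r > 0` (axis included, by continuity) — verbatim `stub_factKerrCubicWeyl` (type D:
`48 Re J`, `J = −Ψ₂³`, `Ψ₂ = −M/(r − i a cos θ)³`). [cite: arXiv07060622, §3 and §5] -/
theorem cubicTrace_kerrBilin_of_ingoing (M a : ℝ)
    (H : ∀ u ∈ (Ingoing.coordDomain 0 : Set E4),
      ∑ i, ∑ i', ∑ j, ∑ j', ∑ k, ∑ k',
        ginv (Ingoing.bilin M a) (EuclideanSpace.basisFun (Fin 4) ℝ).toBasis u i i' *
        ginv (Ingoing.bilin M a) (EuclideanSpace.basisFun (Fin 4) ℝ).toBasis u j j' *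
        ginv (Ingoing.bilin M a) (EuclideanSpace.basisFun (Fin 4) ℝ).toBasis u k k' *
        traceCLM E4 ((riemAt (Ingoing.bilin M a) u (E4.basisVector i) (E4.basisVector j)).comp
          ((riemAt (Ingoing.bilin M a) u (E4.basisVector j') (E4.basisVector k)).comp
            (riemAt (Ingoing.bilin M a) u (E4.basisVector k') (E4.basisVector i')))) =
      48 * M ^ 3 * (u 1 ^ 9 - 36 * u 1 ^ 7 * (a * u 2) ^ 2 + 126 * u 1 ^ 5 * (a * u 2) ^ 4 -
        84 * u 1 ^ 3 * (a * u 2) ^ 6 + 9 * u 1 * (a * u 2) ^ 8) / (u 1 ^ 2 + (a * u 2) ^ 2) ^ 9)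
    (x : E4) (hx : 0 < radius a x) (b : Basis (Fin 4) ℝ E4) :
    ∑ i, ∑ i', ∑ j, ∑ j', ∑ k, ∑ k',
        ginv (Kerr.bilin M a) b x i i' * ginv (Kerr.bilin M a) b x j j' * ginv (Kerr.bilin M a) b x k k' *
        traceCLM E4 ((riemAt (Kerr.bilin M a) x (b i) (b j)).comp
          ((riemAt (Kerr.bilin M a) x (b j') (b k)).comp (riemAt (Kerr.bilin M a) x (b k') (b i')))) =
      48 * M ^ 3 * (((radius a x : ℂ) + ((a * (x 3 / radius a x) : ℝ) : ℂ) * Complex.I) ^ 9).re /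
        (radius a x ^ 2 + (a * (x 3 / radius a x)) ^ 2) ^ 9 := by
  rw [Complex.re_add_mul_I_pow_nine]
  have hxr : x ∈ (region a 0 : Set E4) := by
    rw [SetLike.mem_coe, mem_region, max_self]; exact hx
  set F : E4 → ℝ := fun x ↦ (∑ i, ∑ i', ∑ j, ∑ j', ∑ k, ∑ k',
        ginv (Kerr.bilin M a) b x i i' * ginv (Kerr.bilin M a) b x j j' * ginv (Kerr.bilin M a) b x k k' *
        traceCLM E4 ((riemAt (Kerr.bilin M a) x (b i) (b j)).comp
          ((riemAt (Kerr.bilin M a) x (b j') (b k)).comp (riemAt (Kerr.bilin M a) x (b k') (b i'))))) -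
      48 * M ^ 3 *
      (radius a x ^ 9 - 36 * radius a x ^ 7 * (a * (x 3 / radius a x)) ^ 2 +
        126 * radius a x ^ 5 * (a * (x 3 / radius a x)) ^ 4 -
        84 * radius a x ^ 3 * (a * (x 3 / radius a x)) ^ 6 +
        9 * radius a x * (a * (x 3 / radius a x)) ^ 8) /
      (radius a x ^ 2 + (a * (x 3 / radius a x)) ^ 2) ^ 9 with hF
  have hcont : ContinuousOn F (region a 0 : Set E4) :=
    (((KerrSchildChart.isMetricOn_kerrBilin M a 0).contDiffOn_cubicTrace b).continuousOn).sub
      (continuousOn_cubicRHS M a)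
  have hoff : ∀ y ∈ region a 0, (y 1 ≠ 0 ∨ y 2 ≠ 0) → F y = 0 := by
    intro y hy hax
    obtain ⟨u, hu, rfl⟩ := Ingoing.exists_chartFun_eq hy hax
    simp only [hF]
    rw [Ingoing.cubicTrace_kerrBilin_chartFun M a hu b, H u hu, Ingoing.mul_apply_three_div_radius a hu,
      Ingoing.radius_chartFun_of_mem a hu, sub_self]
  have := eqOn_region_of_offAxis hcont hoff x hxr
  simp only [hF] at this
  linarith

end Kerr

end Literature.Geometry.Lorentzian

end
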